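import Literature.Geometry.Lorentzian.SecondFundamentalFormApply
import Literature.Geometry.Lorentzian.ChartConnection
import Literature.Geometry.Lorentzian.OpensChartGeodesic
import HarnessLib

/-!
# The covariant derivative of a field along a map between chart domains, and the second
# fundamental form, in coordinates

(trunk G08 = T-LORENTZ; namespace `Literature.Geometry.Lorentzian.OpensChart`; companion of
`ChartCalculus.lean`, `ChartConnection.lean`, `SecondFundamentalFormApply.lean`.)

For a metric `g` on a chart domain `V : Opens E` with components `G` (`g.val x = G x`,
`ChartCalculus.lean`: `∇_{X₀} Y₀ = Γ_x(Y₀)(X₀) = christoffel g G x Y₀ X₀` on constant fields), a map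
`f : U → V` from a chart domain `U : Opens E'` with representative `Φ : E' → E`, and a field `ν`
along `f` (`ν y ∈ T_{f y} V = E`) with representative `N : E' → E`, this file proves the
classical coordinate formulas

* `OpensChart.normalDerivAlong_eq_of_repr` — **the induced covariant derivative along `f`**:
  `D_v ν = DN(y) v + Γ_{f y}(N y)(DΦ(y) v)` (O'Neill 1983, Ch. 4, Lemma 4.1:
  `D̄_V X̄ = ∑ V(Xᵏ) ∂_k + ∑ Xʲ D̄_V ∂ⱼ`, with Ch. 3, Prop. 3.13), obtained from the frame formula
  `normalDerivAlong_eq` of `SecondFundamentalFormApply.lean` read in the constant frame of the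
  chart (`localFrame_trivializationAt`, `localFrame_coeff_trivializationAt`, `leviCivita_const`);
* `OpensChart.secondFundamentalForm_eq_of_repr` — **the second fundamental form**
  `K_ν(v, w) = g_{f y}(DN(y) v + Γ_{f y}(N y)(DΦ(y) v), DΦ(y) w)` (O'Neill 1983, Ch. 4,
  Lemma 4.4 ff.; Wald 1984, (10.2.13)), via `secondFundamentalForm_apply`;

together with the bookkeeping `mdifferentiableAt_of_repr`, `mfderiv_apply_of_repr` (maps between
chart domains are differentiated through representatives) and `mdifferentiableAt_lift_of_repr`.
Everything is proved; no definitions, no named facts. Consumed by the closed-form computation of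
the second fundamental form of the Kerr–Schild slices (`KerrDataSchwarzschildExtrinsic.lean`).

## References

* B. O'Neill, *Semi-Riemannian geometry with applications to relativity*, Academic Press 1983,
  Ch. 3, Prop. 3.13 (Christoffel symbols); Ch. 4, Lemma 4.1 (induced connection along a
  submanifold, `D̄_V X̄ = ∑ V(Xᵏ)∂_k + ∑ Xʲ D̄_V ∂ⱼ`), Lemma 4.4 ff. (shape tensor) (key `ONeill1983`).
* R. M. Wald, *General Relativity*, Chicago 1984, (10.2.13) (key `Wald1984`).
-/

noncomputable section

open Bundle TopologicalSpace Manifold Set Module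
open scoped ContDiff Topology

namespace Literature.Geometry.Lorentzian

/-! ### The covariant derivative of a field along a map between chart domains -/

namespace OpensChart

variable {E : Type*} [NormedAddCommGroup E] [NormedSpace ℝ E] [FiniteDimensional ℝ E]
  {E' : Type*} [NormedAddCommGroup E'] [NormedSpace ℝ E']
  {V : Opens E} {U : Opens E'} {n : ℕ∞ω}
  {g : PseudoRiemannianMetric 𝓘(ℝ, E) n E (TangentSpace 𝓘(ℝ, E) : V → Type _)}
  {G : E → E →L[ℝ] E →L[ℝ] ℝ}

omit [FiniteDimensional ℝ E] in
/-- The coefficient functionals of the constant coordinate frame of `TV` (`V : Opens E`) are the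
(constant) coordinate functionals of the basis: `cⁱ_z(w) = bⁱ(w)` (the chart analogue of
`ModelSpace.localFrame_coeff_trivializationAt`). [folklore] -/
theorem localFrame_coeff_trivializationAt {ι : Type*} [Fintype ι] (x : V) (b : Module.Basis ι ℝ E)
    (i : ι) (z : V) (w : E) :
    (trivializationAt E (TangentSpace 𝓘(ℝ, E)) x).localFrame_coeff 𝓘(ℝ, E) b i z w =
      b.repr w i := by
  have hz : z ∈ (trivializationAt E (TangentSpace 𝓘(ℝ, E)) x).baseSet := by
    simp [chartAt_source]
  rw [(trivializationAt E (TangentSpace 𝓘(ℝ, E)) x).localFrame_coeff_eq_coeff (I := 𝓘(ℝ, E))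
    (b := b) (s := fun _ : V ↦ (w : E)) hz]
  simp only [trivializationAt_apply]

omit [FiniteDimensional ℝ E] in
/-- A map `f : U → V` between chart domains whose representative `Φ` (`(f y : E) = Φ y`) is
differentiable at `y` is differentiable at `y` as a map of manifolds. [folklore] -/
theorem mdifferentiableAt_of_repr {f : U → V} {Φ : E' → E} (hf : ∀ y : U, (f y : E) = Φ y)
    {y : U} (hΦ : DifferentiableAt ℝ Φ y) : MDifferentiableAt 𝓘(ℝ, E') 𝓘(ℝ, E) f y := by
  have h : MDifferentiableAt 𝓘(ℝ, E') 𝓘(ℝ, E) (Subtype.val ∘ f) y :=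
    (mdifferentiableAt_iff y (Subtype.val ∘ f) Φ hf).2 hΦ
  exact (ChartedSpace.liftPropWithinAt_subtypeVal_comp_iff f univ y).mp h

omit [FiniteDimensional ℝ E] in
/-- The differential of a map `f : U → V` between chart domains is the Fréchet derivative of its
representative: `df_y v = DΦ(y) v`. [folklore] -/
theorem mfderiv_apply_of_repr {f : U → V} {Φ : E' → E} (hf : ∀ y : U, (f y : E) = Φ y)
    {y : U} (hΦ : DifferentiableAt ℝ Φ y) (v : TangentSpace 𝓘(ℝ, E') y) :
    mfderiv 𝓘(ℝ, E') 𝓘(ℝ, E) f y v = fderiv ℝ Φ y v := by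
  have hfd := mdifferentiableAt_of_repr hf hΦ
  have hval : MDifferentiableAt 𝓘(ℝ, E) 𝓘(ℝ, E) (Subtype.val : V → E) (f y) :=
    (mdifferentiableAt_iff (f y) Subtype.val id (fun _ ↦ rfl)).2 differentiableAt_id
  have h2 : mfderiv 𝓘(ℝ, E) 𝓘(ℝ, E) (Subtype.val : V → E) (f y) = ContinuousLinearMap.id ℝ E := by
    rw [mfderiv_eq (f y) Subtype.val id (fun _ ↦ rfl) differentiableAt_id, fderiv_id]
  have h3 : mfderiv 𝓘(ℝ, E') 𝓘(ℝ, E) (Subtype.val ∘ f) y = fderiv ℝ Φ y :=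
    mfderiv_eq y (Subtype.val ∘ f) Φ hf hΦ
  have h4 := DFunLike.congr_fun (mfderiv_comp y hval hfd) v
  rw [h3, h2] at h4
  exact h4.symm

omit [FiniteDimensional ℝ E] in
/-- The lift `x ↦ (f x, ν x) ∈ TV` of a field `ν` along `f : U → V` with differentiable
representatives is differentiable (the hypothesis of `secondFundamentalForm_apply`). [folklore] -/
theorem mdifferentiableAt_lift_of_repr {f : U → V} {Φ : E' → E} (hf : ∀ y : U, (f y : E) = Φ y)
    {ν : NormalField 𝓘(ℝ, E) f} {N : E' → E} (hν : ∀ y : U, ν y = N y) {y : U}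
    (hΦ : DifferentiableAt ℝ Φ y) (hN : DifferentiableAt ℝ N y) :
    MDifferentiableAt 𝓘(ℝ, E') (𝓘(ℝ, E).prod 𝓘(ℝ, E))
      (fun x ↦ (TotalSpace.mk' E (f x) (ν x) : TangentBundle 𝓘(ℝ, E) V)) y := by
  rw [mdifferentiableAt_totalSpace]
  refine ⟨mdifferentiableAt_of_repr hf hΦ, ?_⟩
  have h : (fun x : U ↦ (trivializationAt E (TangentSpace 𝓘(ℝ, E)) (f y)
      (TotalSpace.mk' E (f x) (ν x) : TangentBundle 𝓘(ℝ, E) V)).2) = fun x : U ↦ N x := by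
    funext x
    rw [show (TotalSpace.mk' E (f x) (ν x) : TangentBundle 𝓘(ℝ, E) V) = ⟨f x, N x⟩ by
      rw [hν x], trivializationAt_apply]
  rw [h]
  exact (mdifferentiableAt_iff y (fun x : U ↦ N x) N (fun _ ↦ rfl)).2 hN

/-- **The covariant derivative of a field along a map between chart domains, in coordinates.**
Let `g` be a metric on `V : Opens E` with differentiable components `G`, `f : U → V` a map from
a chart domain `U : Opens E'` with representative `Φ` differentiable at `y`, and `ν` a field along
`f` (`ν x ∈ T_{f x} V = E`) with representative `N : E' → E` differentiable at `y`. Then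
`D_v ν = DN(y) v + Γ_{f y}(N y)(DΦ(y) v)`, where `Γ_x(Z)(X) = christoffel g G x Z X = ∇_X Z` on
constant fields. This is O'Neill 1983, Ch. 4, Lemma 4.1 (`D̄_V X̄ = ∑ V(fⁱ) ∂ᵢ + ∑ fⁱ D̄_V ∂ᵢ`)
with Ch. 3, Prop. 3.13, read in the constant frame `∂ᵢ` of the chart: the frame formula
`normalDerivAlong_eq` with `localFrame_trivializationAt` (the frame is constant),
`localFrame_coeff_trivializationAt` (its coefficient functionals are the basis coordinates) and
`leviCivita_const` (`∇_X ∂ᵢ = Γ(∂ᵢ)(X)`). [cite: ONeill1983, Ch. 4, Lemma 4.1] -/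
theorem normalDerivAlong_eq_of_repr [g.HasLeviCivita] (hG : ∀ x : V, g.val x = G x)
    {f : U → V} {Φ : E' → E} (hf : ∀ y : U, (f y : E) = Φ y) {ν : NormalField 𝓘(ℝ, E) f}
    {N : E' → E} (hν : ∀ y : U, ν y = N y) {y : U} (hΦ : DifferentiableAt ℝ Φ y)
    (hN : DifferentiableAt ℝ N y) (hGd : DifferentiableAt ℝ G (f y))
    (v : TangentSpace 𝓘(ℝ, E') y) :
    g.normalDerivAlong f ν y v =
      fderiv ℝ N y v + christoffel g G (f y) (N y) (fderiv ℝ Φ y v) := by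
  have hlift := mdifferentiableAt_lift_of_repr hf hν hΦ hN
  rw [g.normalDerivAlong_eq (I' := 𝓘(ℝ, E')) BoundarylessManifold.isInteriorPoint hlift v]
  set b := Module.finBasis ℝ E with hb
  -- the four ingredients of the frame formula in the constant frame `∂ᵢ = bᵢ` of the
  -- trivialisation of `TV` at `f y` (which cannot be abbreviated: its atlas instance depends on it)
  have h1 : ∀ i, mfderiv 𝓘(ℝ, E') 𝓘(ℝ, ℝ) (fun x : U ↦
      (trivializationAt E (TangentSpace 𝓘(ℝ, E) : V → Type _) (f y)).localFrame_coeff 𝓘(ℝ, E) b i (f x) (ν x)) y v = b.repr (fderiv ℝ N y v) i := by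
    intro i
    set L : E →L[ℝ] ℝ := LinearMap.toContinuousLinearMap (b.coord i) with hL
    have hrep : ∀ x : U, (trivializationAt E (TangentSpace 𝓘(ℝ, E) : V → Type _) (f y)).localFrame_coeff 𝓘(ℝ, E) b i (f x) (ν x) = (L ∘ N) x := fun x ↦ by
      rw [localFrame_coeff_trivializationAt, hν x]
      rfl
    have hd : HasFDerivAt (L ∘ N) (L.comp (fderiv ℝ N y)) y := L.hasFDerivAt.comp _ hN.hasFDerivAt
    rw [mfderiv_eq y _ _ hrep hd.differentiableAt, hd.fderiv]
    rfl
  have h2 : ∀ i, (trivializationAt E (TangentSpace 𝓘(ℝ, E) : V → Type _) (f y)).localFrame b i (f y) = b i := fun i ↦ by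
    rw [localFrame_trivializationAt]
  have h3 : ∀ i, (trivializationAt E (TangentSpace 𝓘(ℝ, E) : V → Type _) (f y)).localFrame_coeff 𝓘(ℝ, E) b i (f y) (ν y) = b.repr (N y) i := fun i ↦ by
    rw [localFrame_coeff_trivializationAt, hν y]
  have h4 : ∀ i, g.leviCivita ((trivializationAt E (TangentSpace 𝓘(ℝ, E) : V → Type _) (f y)).localFrame b i) (f y) (mfderiv 𝓘(ℝ, E') 𝓘(ℝ, E) f y v) =
      christoffel g G (f y) (b i) (fderiv ℝ Φ y v) := fun i ↦ by
    rw [localFrame_trivializationAt, leviCivita_const hG (f y) hGd, mfderiv_apply_of_repr hf hΦ]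
    rfl
  -- assemble: `∑ bⁱ(DN v) bᵢ + Γ(∑ bⁱ(N) bᵢ)(DΦ v)`
  refine Eq.trans (b := ∑ i, (b.repr (fderiv ℝ N y v) i) • (b i : E) +
    ∑ i, (b.repr (N y) i) • christoffel g G (f y) (b i) (fderiv ℝ Φ y v)) ?_ ?_
  · congr 1
    · refine Finset.sum_congr rfl fun i _ ↦ ?_
      rw [h2 i]
      exact congrArg (fun c : ℝ ↦ c • (b i : E)) (h1 i)
    · refine Finset.sum_congr rfl fun i _ ↦ ?_
      rw [h3 i, h4 i]
      rfl
  · rw [b.sum_repr, ← christoffel_sum, b.sum_repr]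

/-- **The second fundamental form of a map between chart domains, in coordinates**:
`K_ν(v, w) = g_{f y}(DN(y) v + Γ_{f y}(N y)(DΦ(y) v), DΦ(y) w)` (`secondFundamentalForm_apply`
with `normalDerivAlong_eq_of_repr` and `mfderiv_apply_of_repr`). O'Neill 1983, Ch. 4,
Lemma 4.1 and Lemma 4.4 ff.; Wald 1984, (10.2.13). [cite: ONeill1983, Ch. 4, Lemma 4.1] -/
theorem secondFundamentalForm_eq_of_repr [FiniteDimensional ℝ E'] [g.HasLeviCivita]
    (hG : ∀ x : V, g.val x = G x) {f : U → V} {Φ : E' → E} (hf : ∀ y : U, (f y : E) = Φ y)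
    {ν : NormalField 𝓘(ℝ, E) f} {N : E' → E} (hν : ∀ y : U, ν y = N y) {y : U}
    (hΦ : DifferentiableAt ℝ Φ y) (hN : DifferentiableAt ℝ N y)
    (hGd : DifferentiableAt ℝ G (f y)) (v w : TangentSpace 𝓘(ℝ, E') y) :
    g.secondFundamentalForm 𝓘(ℝ, E') f ν y v w =
      g.val (f y) (fderiv ℝ N y v + christoffel g G (f y) (N y) (fderiv ℝ Φ y v))
        (fderiv ℝ Φ y w) := by
  rw [PseudoRiemannianMetric.secondFundamentalForm_apply_holds (I' := 𝓘(ℝ, E'))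
    BoundarylessManifold.isInteriorPoint (mdifferentiableAt_lift_of_repr hf hν hΦ hN) v w,
    normalDerivAlong_eq_of_repr hG hf hν hΦ hN hGd, mfderiv_apply_of_repr hf hΦ]

end OpensChart

end Literature.Geometry.Lorentzian

end
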